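import Summits.HodgeConjecture.HodgeConjecture.Theorems.F0P3cStCharTSOffStratumG         -- ★ p849348 (this seat): D3-iii-G
import Summits.HodgeConjecture.HodgeConjecture.Theorems.F0P3cStCharTSOffStratumH         -- filed p849380 (this seat): D3-iii-H
import Summits.HodgeConjecture.HodgeConjecture.Theorems.F0P3cStCharTSTransferVanish      -- ★ p849275 (this seat): `isDeltaTransferRel_of_on_off`
import HarnessLib

/-!
# F0 · P3c · line LH6 «StCharTS» — road (D) «DEEP-FL», brick D3-iii «OFF-STRATUM ⇒ SUPPORT-DISJOINTNESS» on the CM carriers, and D3 «MATCH» REDUCED TO THE ON-STRATUM IDENTITY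

Cell `pub/hodgecm-mathlib`, crux H413 = `stmt-HodgeConjecture-24833` (`--supports` lane, helper), route HCCMUnconditional; seat LH6-p04 (g2), road (D) owner;
status v3 `F0/P3b/LH6-p04/g2/ROAD-D.status.v3.txt` brick D3-iii (wrapper) + the D3 skeleton.  THEOREMS ONLY, sorry-free.  HONEST LABEL: HC_CM is proved only modulo
the 7 printed citations (2 remaining: hLiu418 = stmt-HodgeConjecture-24832, h413 = stmt-HodgeConjecture-24833) until rung 0 closes; count-neutral.

THE ON-STRATUM PREDICATE used here is the valuation inequality `ON(γ_H) :⟺ |det h₂|_w < |tr h₂|_w²` (`h₂ = γ_H.1` read at `w`); ★ HYP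
`exists_mem_unitaryGroup_eigenframe_of_valued_det_lt` turns it into a unitary eigenframe when D3-iv needs one.
* §1 `conj_notMem_tsupport_of_not_on_G` («hoffG»): for `f` with `tsupport f ⊆ K_n (z aᵐ) K_n` — e.g. `f = 𝟙_{K_n (z aᵐ) K_n}` or `c • 𝟙` — and `γ_H` OFF the
  stratum, NO Δ-matched class of `G` has a conjugate in `tsupport f` (contrapositive of ★ D3-iii-G).
* §1 `conj_notMem_tsupport_of_not_on_H` («hoffH»): for `f^H` with `(tsupport f^H).1 ⊆ K₂ (z₂ a₂^m₂) K₂` — e.g. `f^H = c_b • 𝟙_{K_H (z₂ a₂^m₂, z₁) K_H}` — and `γ_H` OFF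
  the stratum, NO class of `H` stably conjugate to `γ_H` has a conjugate in `tsupport f^H` (contrapositive of D3-iii-H).
* §2 `isLocalDeltaTransfer_of_on` («D3 ⇐ D3-iv»): for such a pair `(f^H, f)`, ★ `IsLocalDeltaTransfer T mH mG f^H f` FOLLOWS from the transfer identity at the
  `G`-regular ON-stratum elements alone (★ `isDeltaTransferRel_of_on_off`).
[Rogawski1990, §4.3 (4.3.1) p. 43; §12.7 L. 12.7.3 (proof) p. 195.]

## References
* [Rogawski1990] J. D. Rogawski, *Automorphic Representations of Unitary Groups in Three Variables*, Ann. of Math. Stud. 123 (1990), §4.3 p. 43; §12.7 p. 195.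
* [PlatonovRapinchuk1994] V. Platonov, A. Rapinchuk, *Algebraic Groups and Number Theory* (1994), §5.1 (the one-place model).
-/

set_option autoImplicit false
-- the mandated namespace has the single-problem summit's repeated segment (`HodgeConjecture.HodgeConjecture`)
set_option linter.dupNamespace false

noncomputable section

open Matrix Polynomial NumberField IsDedekindDomain
open scoped MatrixGroups
open Literature.NumberTheory.Rogawski1990 Literature.NumberTheory.Automorphic Literature.NumberTheory.Automorphic.UnitaryGroup
open Literature.NumberTheory.GaloisRepresentations

namespace Summit.HodgeConjecture.HodgeConjecture.Cruxes.H413.F0P3cStCharTSOffStratumCM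

variable (L : Type) [Field L] [NumberField L] [IsCMField L] (v : HeightOneSpectrum (𝓞 ↥(maximalRealSubfield L)))
  (w : PlacesOver L v) (hw : IsCMField.complexConj L • w.1 = w.1)

/-! ## §1 OFF the stratum ⇒ support-disjointness («hoffG», «hoffH») -/

set_option maxHeartbeats 1600000 in  -- statement-level `whnf` on the CM carriers
/-- **«hoffG».**  `G`-side data as in ★ D3-iii-G (`K_n` of level `r < 1` under `E₃`, `E₃ z = β·1`, `|β| = 1`, `E₃ a = diag(α, 1, (σ_w α)⁻¹)`, `0 < |α| < 1`, `m ≥ 1`), a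
transfer factor `T`, and a test function `f` with `tsupport f ⊆ K_n (z aᵐ) K_n`.  If `γ_H` is OFF the stratum (`¬ |det h₂|_w < |tr h₂|_w²`), then for every class `c`
with `T.Δ γ_H (out c) ≠ 0` and every `x ∈ G`: `x · out c · x⁻¹ ∉ tsupport f`. [cite: Rogawski1990, §4.3 p. 43; §12.7 L. 12.7.3 (proof) p. 195] -/
theorem conj_notMem_tsupport_of_not_on_G
    (Kn : Subgroup ((cmDatum L 3 (qsForm L)).Local v)) {r : WithZero (Multiplicative ℤ)} (hr : r < 1)
    (hK : ∀ k ∈ Kn, ∀ i j, Valued.v ((((localNonsplitEquiv (IsCMField.complexConj L) (qsForm L) (IsCMField.complexConj_ne_one L) w hw k :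
        ↥(unitaryGroupOfForm (galAdicCompletionMap (L := L) (IsCMField.complexConj L) hw) (placeForm (qsForm L) w.1))) :
        GL (Fin 3) (w.1.adicCompletion L)) : Matrix (Fin 3) (Fin 3) (w.1.adicCompletion L)) i j - (1 : Matrix (Fin 3) (Fin 3) (w.1.adicCompletion L)) i j) ≤ r)
    {z a : (cmDatum L 3 (qsForm L)).Local v} {β α : w.1.adicCompletion L}
    (hz : (((localNonsplitEquiv (IsCMField.complexConj L) (qsForm L) (IsCMField.complexConj_ne_one L) w hw z :
        ↥(unitaryGroupOfForm (galAdicCompletionMap (L := L) (IsCMField.complexConj L) hw) (placeForm (qsForm L) w.1))) :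
        GL (Fin 3) (w.1.adicCompletion L)) : Matrix (Fin 3) (Fin 3) (w.1.adicCompletion L)) = β • (1 : Matrix (Fin 3) (Fin 3) (w.1.adicCompletion L)))
    (hβ : Valued.v β = 1)
    (ha : (((localNonsplitEquiv (IsCMField.complexConj L) (qsForm L) (IsCMField.complexConj_ne_one L) w hw a :
        ↥(unitaryGroupOfForm (galAdicCompletionMap (L := L) (IsCMField.complexConj L) hw) (placeForm (qsForm L) w.1))) :
        GL (Fin 3) (w.1.adicCompletion L)) : Matrix (Fin 3) (Fin 3) (w.1.adicCompletion L)) =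
        Matrix.diagonal ![α, 1, ((galAdicCompletionMap (L := L) (IsCMField.complexConj L) hw) α)⁻¹])
    (hα0 : α ≠ 0) (hα1 : Valued.v α < 1) {m : ℕ} (hm : 1 ≤ m)
    [∀ γ : (cmDatum L 3 (qsForm L)).Local v, MeasurableSpace ((cmDatum L 3 (qsForm L)).Local v ⧸ Subgroup.centralizer ({γ} : Set ((cmDatum L 3 (qsForm L)).Local v)))]
    [∀ aH : ((cmDatum L 2 (Matrix.of fun i j : Fin 2 => if i.val + j.val + 1 = 2 then (1 : L) else 0)).Local v × (cmDatum L 1 (Matrix.of fun i j : Fin 1 => if i.val + j.val + 1 = 1 then (1 : L) else 0)).Local v),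
      MeasurableSpace (((cmDatum L 2 (Matrix.of fun i j : Fin 2 => if i.val + j.val + 1 = 2 then (1 : L) else 0)).Local v × (cmDatum L 1 (Matrix.of fun i j : Fin 1 => if i.val + j.val + 1 = 1 then (1 : L) else 0)).Local v) ⧸
        Subgroup.centralizer ({aH} : Set ((cmDatum L 2 (Matrix.of fun i j : Fin 2 => if i.val + j.val + 1 = 2 then (1 : L) else 0)).Local v × (cmDatum L 1 (Matrix.of fun i j : Fin 1 => if i.val + j.val + 1 = 1 then (1 : L) else 0)).Local v)))]
    (T : LocalTransferFactor L (qsForm L) v) (f : (cmDatum L 3 (qsForm L)).Local v → ℂ)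
    (hf : tsupport f ⊆ DoubleCoset.doubleCoset (z * a ^ m) (Kn : Set ((cmDatum L 3 (qsForm L)).Local v)) Kn)
    (γH : ((cmDatum L 2 (Matrix.of fun i j : Fin 2 => if i.val + j.val + 1 = 2 then (1 : L) else 0)).Local v ×
      (cmDatum L 1 (Matrix.of fun i j : Fin 1 => if i.val + j.val + 1 = 1 then (1 : L) else 0)).Local v))
    (hoff : ¬ (Valued.v ((Pi.evalRingHom (fun w' : PlacesOver L v => w'.1.adicCompletion L) w) ((γH.1.val : GL (Fin 2) (LocalRing L v)) : Matrix (Fin 2) (Fin 2) (LocalRing L v)).det) <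
        Valued.v ((Pi.evalRingHom (fun w' : PlacesOver L v => w'.1.adicCompletion L) w) ((γH.1.val : GL (Fin 2) (LocalRing L v)) : Matrix (Fin 2) (Fin 2) (LocalRing L v)).trace) ^ 2)) (c : ConjClasses ((cmDatum L 3 (qsForm L)).Local v)) (hΔ : T.Δ γH (Quotient.out c) ≠ 0) (x : (cmDatum L 3 (qsForm L)).Local v) :
    x * Quotient.out c * x⁻¹ ∉ tsupport f :=
  fun hx => hoff (F0P3cStCharTSOffStratumG.valued_det_lt_trace_sq_of_delta_ne_zero_of_conj_mem_shell L v w hw Kn hr hK hz hβ ha hα0 hα1 hm T γH c hΔ x (hf hx))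

set_option maxHeartbeats 1600000 in  -- statement-level `whnf` on the CM carriers
/-- **«hoffH».**  `H`-side data as in D3-iii-H (`K₂ ≤ U(Φ₂)_v` of level `r₂ < 1` under `E₂`, `E₂ z₂ = β₂·1`, `|β₂| = 1`, `E₂ a₂ = diag(α₂, (σ_w α₂)⁻¹)`, `0 < |α₂| < 1`,
`m₂ ≥ 1`) and a function `f^H` on `H_v` whose support has FIRST COMPONENTS in the shell `K₂ (z₂ a₂^m₂) K₂` (e.g. `c • 𝟙_{K_H (z₂ a₂^m₂, z₁) K_H}`, `K_H = K₂ × K₁`).  If `γ_H`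
is OFF the stratum, then for every class `c` of `H_v` STABLY CONJUGATE to `γ_H` and every `x ∈ H_v`: `x · out c · x⁻¹ ∉ tsupport f^H`.
[cite: Rogawski1990, §3.1 p. 19; §4.3 p. 43; §12.7 L. 12.7.3 (proof) p. 195] -/
theorem conj_notMem_tsupport_of_not_on_H
    (K₂ : Subgroup ((cmDatum L 2 (Matrix.of fun i j : Fin 2 => if i.val + j.val + 1 = 2 then (1 : L) else 0)).Local v)) {r₂ : WithZero (Multiplicative ℤ)} (hr₂ : r₂ < 1)
    (hK₂ : ∀ k ∈ K₂, ∀ i j, Valued.v ((((localNonsplitEquiv (IsCMField.complexConj L) (Matrix.of fun i j : Fin 2 => if i.val + j.val + 1 = 2 then (1 : L) else 0) (IsCMField.complexConj_ne_one L) w hw k :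
        ↥(unitaryGroupOfForm (galAdicCompletionMap (L := L) (IsCMField.complexConj L) hw) (placeForm (Matrix.of fun i j : Fin 2 => if i.val + j.val + 1 = 2 then (1 : L) else 0) w.1))) :
        GL (Fin 2) (w.1.adicCompletion L)) : Matrix (Fin 2) (Fin 2) (w.1.adicCompletion L)) i j - (1 : Matrix (Fin 2) (Fin 2) (w.1.adicCompletion L)) i j) ≤ r₂)
    {z₂ a₂ : (cmDatum L 2 (Matrix.of fun i j : Fin 2 => if i.val + j.val + 1 = 2 then (1 : L) else 0)).Local v} {β₂ α₂ : w.1.adicCompletion L}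
    (hz₂ : (((localNonsplitEquiv (IsCMField.complexConj L) (Matrix.of fun i j : Fin 2 => if i.val + j.val + 1 = 2 then (1 : L) else 0) (IsCMField.complexConj_ne_one L) w hw z₂ :
        ↥(unitaryGroupOfForm (galAdicCompletionMap (L := L) (IsCMField.complexConj L) hw) (placeForm (Matrix.of fun i j : Fin 2 => if i.val + j.val + 1 = 2 then (1 : L) else 0) w.1))) :
        GL (Fin 2) (w.1.adicCompletion L)) : Matrix (Fin 2) (Fin 2) (w.1.adicCompletion L)) = β₂ • (1 : Matrix (Fin 2) (Fin 2) (w.1.adicCompletion L)))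
    (hβ₂ : Valued.v β₂ = 1)
    (ha₂ : (((localNonsplitEquiv (IsCMField.complexConj L) (Matrix.of fun i j : Fin 2 => if i.val + j.val + 1 = 2 then (1 : L) else 0) (IsCMField.complexConj_ne_one L) w hw a₂ :
        ↥(unitaryGroupOfForm (galAdicCompletionMap (L := L) (IsCMField.complexConj L) hw) (placeForm (Matrix.of fun i j : Fin 2 => if i.val + j.val + 1 = 2 then (1 : L) else 0) w.1))) :
        GL (Fin 2) (w.1.adicCompletion L)) : Matrix (Fin 2) (Fin 2) (w.1.adicCompletion L)) =
        Matrix.diagonal ![α₂, ((galAdicCompletionMap (L := L) (IsCMField.complexConj L) hw) α₂)⁻¹])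
    (hα₂0 : α₂ ≠ 0) (hα₂1 : Valued.v α₂ < 1) {m₂ : ℕ} (hm₂ : 1 ≤ m₂)
    (fH : ((cmDatum L 2 (Matrix.of fun i j : Fin 2 => if i.val + j.val + 1 = 2 then (1 : L) else 0)).Local v ×
      (cmDatum L 1 (Matrix.of fun i j : Fin 1 => if i.val + j.val + 1 = 1 then (1 : L) else 0)).Local v) → ℂ)
    (hfH : ∀ x ∈ tsupport fH, x.1 ∈ DoubleCoset.doubleCoset (z₂ * a₂ ^ m₂) (K₂ : Set ((cmDatum L 2 (Matrix.of fun i j : Fin 2 => if i.val + j.val + 1 = 2 then (1 : L) else 0)).Local v)) K₂)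
    (γH : ((cmDatum L 2 (Matrix.of fun i j : Fin 2 => if i.val + j.val + 1 = 2 then (1 : L) else 0)).Local v ×
      (cmDatum L 1 (Matrix.of fun i j : Fin 1 => if i.val + j.val + 1 = 1 then (1 : L) else 0)).Local v))
    (hoff : ¬ (Valued.v ((Pi.evalRingHom (fun w' : PlacesOver L v => w'.1.adicCompletion L) w) ((γH.1.val : GL (Fin 2) (LocalRing L v)) : Matrix (Fin 2) (Fin 2) (LocalRing L v)).det) <
        Valued.v ((Pi.evalRingHom (fun w' : PlacesOver L v => w'.1.adicCompletion L) w) ((γH.1.val : GL (Fin 2) (LocalRing L v)) : Matrix (Fin 2) (Fin 2) (LocalRing L v)).trace) ^ 2)) (c : ConjClasses ((cmDatum L 2 (Matrix.of fun i j : Fin 2 => if i.val + j.val + 1 = 2 then (1 : L) else 0)).Local v ×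
      (cmDatum L 1 (Matrix.of fun i j : Fin 1 => if i.val + j.val + 1 = 1 then (1 : L) else 0)).Local v))
    (hst : IsLocalStablyConjH L v γH (Quotient.out c)) (x : ((cmDatum L 2 (Matrix.of fun i j : Fin 2 => if i.val + j.val + 1 = 2 then (1 : L) else 0)).Local v ×
      (cmDatum L 1 (Matrix.of fun i j : Fin 1 => if i.val + j.val + 1 = 1 then (1 : L) else 0)).Local v)) :
    x * Quotient.out c * x⁻¹ ∉ tsupport fH := by
  intro hx
  have h1 := hfH _ hx
  rw [Prod.fst_mul, Prod.fst_mul, Prod.fst_inv] at h1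
  exact hoff (F0P3cStCharTSOffStratumH.valued_det_lt_trace_sq_of_isLocalStablyConjH_of_conj_mem_shell L v w hw K₂ hr₂ hK₂ hz₂ hβ₂ ha₂ hα₂0 hα₂1 hm₂
    γH (Quotient.out c) hst x.1 h1)

/-! ## §2 D3 «MATCH» reduced to the ON-stratum identity -/

set_option maxHeartbeats 1600000 in  -- statement-level `whnf` on the CM carriers
/-- **D3 ⇐ D3-iv.**  With the `G`-side and `H`-side shell data of §1, a transfer factor `T` (e.g. Δ‴), orbital measure families `mH, mG`, and a pair `(f^H, f)` with
`tsupport f ⊆ K_n (z aᵐ) K_n` and `(tsupport f^H).1 ⊆ K₂ (z₂ a₂^m₂) K₂`: if the transfer identity `Φ^st(γ_H, f^H) = Σ_c Δ(γ_H, c) Φ(c, f)` holds at every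
`G`-regular `γ_H` ON the stratum (`|det h₂|_w < |tr h₂|_w²`), then `f^H` is a `Δ`-transfer of `f`: ★ `IsLocalDeltaTransfer L Φ₃ v T mH mG f^H f`.
[cite: Rogawski1990, §4.3 (4.3.1) p. 43; §12.7 L. 12.7.3 (proof) p. 195] -/
theorem isLocalDeltaTransfer_of_on
    (Kn : Subgroup ((cmDatum L 3 (qsForm L)).Local v)) {r : WithZero (Multiplicative ℤ)} (hr : r < 1)
    (hK : ∀ k ∈ Kn, ∀ i j, Valued.v ((((localNonsplitEquiv (IsCMField.complexConj L) (qsForm L) (IsCMField.complexConj_ne_one L) w hw k :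
        ↥(unitaryGroupOfForm (galAdicCompletionMap (L := L) (IsCMField.complexConj L) hw) (placeForm (qsForm L) w.1))) :
        GL (Fin 3) (w.1.adicCompletion L)) : Matrix (Fin 3) (Fin 3) (w.1.adicCompletion L)) i j - (1 : Matrix (Fin 3) (Fin 3) (w.1.adicCompletion L)) i j) ≤ r)
    {z a : (cmDatum L 3 (qsForm L)).Local v} {β α : w.1.adicCompletion L}
    (hz : (((localNonsplitEquiv (IsCMField.complexConj L) (qsForm L) (IsCMField.complexConj_ne_one L) w hw z :
        ↥(unitaryGroupOfForm (galAdicCompletionMap (L := L) (IsCMField.complexConj L) hw) (placeForm (qsForm L) w.1))) :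
        GL (Fin 3) (w.1.adicCompletion L)) : Matrix (Fin 3) (Fin 3) (w.1.adicCompletion L)) = β • (1 : Matrix (Fin 3) (Fin 3) (w.1.adicCompletion L)))
    (hβ : Valued.v β = 1)
    (ha : (((localNonsplitEquiv (IsCMField.complexConj L) (qsForm L) (IsCMField.complexConj_ne_one L) w hw a :
        ↥(unitaryGroupOfForm (galAdicCompletionMap (L := L) (IsCMField.complexConj L) hw) (placeForm (qsForm L) w.1))) :
        GL (Fin 3) (w.1.adicCompletion L)) : Matrix (Fin 3) (Fin 3) (w.1.adicCompletion L)) =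
        Matrix.diagonal ![α, 1, ((galAdicCompletionMap (L := L) (IsCMField.complexConj L) hw) α)⁻¹])
    (hα0 : α ≠ 0) (hα1 : Valued.v α < 1) {m : ℕ} (hm : 1 ≤ m)
    (K₂ : Subgroup ((cmDatum L 2 (Matrix.of fun i j : Fin 2 => if i.val + j.val + 1 = 2 then (1 : L) else 0)).Local v)) {r₂ : WithZero (Multiplicative ℤ)} (hr₂ : r₂ < 1)
    (hK₂ : ∀ k ∈ K₂, ∀ i j, Valued.v ((((localNonsplitEquiv (IsCMField.complexConj L) (Matrix.of fun i j : Fin 2 => if i.val + j.val + 1 = 2 then (1 : L) else 0) (IsCMField.complexConj_ne_one L) w hw k :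
        ↥(unitaryGroupOfForm (galAdicCompletionMap (L := L) (IsCMField.complexConj L) hw) (placeForm (Matrix.of fun i j : Fin 2 => if i.val + j.val + 1 = 2 then (1 : L) else 0) w.1))) :
        GL (Fin 2) (w.1.adicCompletion L)) : Matrix (Fin 2) (Fin 2) (w.1.adicCompletion L)) i j - (1 : Matrix (Fin 2) (Fin 2) (w.1.adicCompletion L)) i j) ≤ r₂)
    {z₂ a₂ : (cmDatum L 2 (Matrix.of fun i j : Fin 2 => if i.val + j.val + 1 = 2 then (1 : L) else 0)).Local v} {β₂ α₂ : w.1.adicCompletion L}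
    (hz₂ : (((localNonsplitEquiv (IsCMField.complexConj L) (Matrix.of fun i j : Fin 2 => if i.val + j.val + 1 = 2 then (1 : L) else 0) (IsCMField.complexConj_ne_one L) w hw z₂ :
        ↥(unitaryGroupOfForm (galAdicCompletionMap (L := L) (IsCMField.complexConj L) hw) (placeForm (Matrix.of fun i j : Fin 2 => if i.val + j.val + 1 = 2 then (1 : L) else 0) w.1))) :
        GL (Fin 2) (w.1.adicCompletion L)) : Matrix (Fin 2) (Fin 2) (w.1.adicCompletion L)) = β₂ • (1 : Matrix (Fin 2) (Fin 2) (w.1.adicCompletion L)))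
    (hβ₂ : Valued.v β₂ = 1)
    (ha₂ : (((localNonsplitEquiv (IsCMField.complexConj L) (Matrix.of fun i j : Fin 2 => if i.val + j.val + 1 = 2 then (1 : L) else 0) (IsCMField.complexConj_ne_one L) w hw a₂ :
        ↥(unitaryGroupOfForm (galAdicCompletionMap (L := L) (IsCMField.complexConj L) hw) (placeForm (Matrix.of fun i j : Fin 2 => if i.val + j.val + 1 = 2 then (1 : L) else 0) w.1))) :
        GL (Fin 2) (w.1.adicCompletion L)) : Matrix (Fin 2) (Fin 2) (w.1.adicCompletion L)) =
        Matrix.diagonal ![α₂, ((galAdicCompletionMap (L := L) (IsCMField.complexConj L) hw) α₂)⁻¹])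
    (hα₂0 : α₂ ≠ 0) (hα₂1 : Valued.v α₂ < 1) {m₂ : ℕ} (hm₂ : 1 ≤ m₂)
    [∀ γ : (cmDatum L 3 (qsForm L)).Local v, MeasurableSpace ((cmDatum L 3 (qsForm L)).Local v ⧸ Subgroup.centralizer ({γ} : Set ((cmDatum L 3 (qsForm L)).Local v)))]
    [∀ aH : ((cmDatum L 2 (Matrix.of fun i j : Fin 2 => if i.val + j.val + 1 = 2 then (1 : L) else 0)).Local v × (cmDatum L 1 (Matrix.of fun i j : Fin 1 => if i.val + j.val + 1 = 1 then (1 : L) else 0)).Local v),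
      MeasurableSpace (((cmDatum L 2 (Matrix.of fun i j : Fin 2 => if i.val + j.val + 1 = 2 then (1 : L) else 0)).Local v × (cmDatum L 1 (Matrix.of fun i j : Fin 1 => if i.val + j.val + 1 = 1 then (1 : L) else 0)).Local v) ⧸
        Subgroup.centralizer ({aH} : Set ((cmDatum L 2 (Matrix.of fun i j : Fin 2 => if i.val + j.val + 1 = 2 then (1 : L) else 0)).Local v × (cmDatum L 1 (Matrix.of fun i j : Fin 1 => if i.val + j.val + 1 = 1 then (1 : L) else 0)).Local v)))]
    (T : LocalTransferFactor L (qsForm L) v)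
    (mH : OrbitalMeasureFamily ((cmDatum L 2 (Matrix.of fun i j : Fin 2 => if i.val + j.val + 1 = 2 then (1 : L) else 0)).Local v ×
      (cmDatum L 1 (Matrix.of fun i j : Fin 1 => if i.val + j.val + 1 = 1 then (1 : L) else 0)).Local v))
    (mG : OrbitalMeasureFamily ((cmDatum L 3 (qsForm L)).Local v))
    (fH : ((cmDatum L 2 (Matrix.of fun i j : Fin 2 => if i.val + j.val + 1 = 2 then (1 : L) else 0)).Local v ×
      (cmDatum L 1 (Matrix.of fun i j : Fin 1 => if i.val + j.val + 1 = 1 then (1 : L) else 0)).Local v) → ℂ)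
    (hfH : ∀ x ∈ tsupport fH, x.1 ∈ DoubleCoset.doubleCoset (z₂ * a₂ ^ m₂) (K₂ : Set ((cmDatum L 2 (Matrix.of fun i j : Fin 2 => if i.val + j.val + 1 = 2 then (1 : L) else 0)).Local v)) K₂)
    (f : (cmDatum L 3 (qsForm L)).Local v → ℂ)
    (hf : tsupport f ⊆ DoubleCoset.doubleCoset (z * a ^ m) (Kn : Set ((cmDatum L 3 (qsForm L)).Local v)) Kn)
    (hon : ∀ γH : ((cmDatum L 2 (Matrix.of fun i j : Fin 2 => if i.val + j.val + 1 = 2 then (1 : L) else 0)).Local v × (cmDatum L 1 (Matrix.of fun i j : Fin 1 => if i.val + j.val + 1 = 1 then (1 : L) else 0)).Local v),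
      IsLocalGRegular L v γH → Valued.v ((Pi.evalRingHom (fun w' : PlacesOver L v => w'.1.adicCompletion L) w) ((γH.1.val : GL (Fin 2) (LocalRing L v)) : Matrix (Fin 2) (Fin 2) (LocalRing L v)).det) <
        Valued.v ((Pi.evalRingHom (fun w' : PlacesOver L v => w'.1.adicCompletion L) w) ((γH.1.val : GL (Fin 2) (LocalRing L v)) : Matrix (Fin 2) (Fin 2) (LocalRing L v)).trace) ^ 2 →
      stableOrbitalIntegralRel (IsLocalStablyConjH L v) mH fH γH = ∑ᶠ c : ConjClasses ((cmDatum L 3 (qsForm L)).Local v), T.Δ γH (Quotient.out c) * classOrbitalIntegral mG f c) :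
    IsLocalDeltaTransfer L (qsForm L) v T mH mG fH f :=
  F0P3cStCharTSTransferVanish.isDeltaTransferRel_of_on_off (IsLocalStablyConjH L v) (IsLocalGRegular L v)
    (fun γH : ((cmDatum L 2 (Matrix.of fun i j : Fin 2 => if i.val + j.val + 1 = 2 then (1 : L) else 0)).Local v × (cmDatum L 1 (Matrix.of fun i j : Fin 1 => if i.val + j.val + 1 = 1 then (1 : L) else 0)).Local v) => Valued.v ((Pi.evalRingHom (fun w' : PlacesOver L v => w'.1.adicCompletion L) w) ((γH.1.val : GL (Fin 2) (LocalRing L v)) : Matrix (Fin 2) (Fin 2) (LocalRing L v)).det) <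
        Valued.v ((Pi.evalRingHom (fun w' : PlacesOver L v => w'.1.adicCompletion L) w) ((γH.1.val : GL (Fin 2) (LocalRing L v)) : Matrix (Fin 2) (Fin 2) (LocalRing L v)).trace) ^ 2)
    T mH mG fH f hon
    (fun γH _ hoff c hst x => conj_notMem_tsupport_of_not_on_H L v w hw K₂ hr₂ hK₂ hz₂ hβ₂ ha₂ hα₂0 hα₂1 hm₂ fH hfH γH hoff c hst x)
    (fun γH _ hoff c hΔ x => conj_notMem_tsupport_of_not_on_G L v w hw Kn hr hK hz hβ ha hα0 hα1 hm T f hf γH hoff c hΔ x)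

end Summit.HodgeConjecture.HodgeConjecture.Cruxes.H413.F0P3cStCharTSOffStratumCM
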